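import Mathlib
import HarnessLib
import HarnessLib.Audit
import Summits.NavierStokesRegularity.Statement
import Literature.Analysis.FluidPDE.ClassicalSolution
import Literature.Analysis.FluidPDE.LerayHopf
import Literature.Analysis.FluidPDE.NSWave0
import Literature.Analysis.FluidPDE.SuitableWeak
import Literature.Analysis.FluidPDE.SelfSimilar
import Literature.Analysis.FluidPDE.BlowupAncientSolution
import Literature.Analysis.FluidPDE.Vorticity
import Literature.Analysis.FluidPDE.VectorCalculus
import Summits.NavierStokesRegularity.NavierStokesRegularity.Theorems.TypeICertificateLadderNoBlowupToClay

/-!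
Route: IsobarTomography

DORMANT since 2026-09-04T10:53:05Z (reconciler: no traction for 5 d (last activity statement-claimed at 2026-08-30T10:20:50Z); parked, not closed — `ledger route dormant route-NavierStokesRegularity-IsobarTomography --off` to reactivate) — unstaffed, not closed; items shared with open routes are served there. `ledger route dormant <id> --off` reactivates.

# Route IsobarTomography — isobar tomography — blob cores close the stretching Riccati law, tube
cores reduce to a Liouville theorem for isobaric vortex lines

X = D ∧ K1 ∧ K2 ∧ N ("it suffices to show"), realising card
isobar-curvature-tomography-pressure-hessian (spine; v1 isobar-gauss-bonnet-pressure-hessian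
absorbed). At a first singular time of a Clay solution the isobar geometry around the intense
vorticity is either BLOB (χ = 2: nested spherical isobars, the vortex line through the core bottom
sees a strict pressure minimum, ∂²_ξp ≥ 2κQ) or TUBE (χ = 0: isobars are tori carrying the vortex
lines, ω·∇p ≡ 0 in the zoom limit) — Poincaré–Hopf / hairy-ball is the dictionary between the card's
Euler characteristics and these typable conditions. D (TubeAlternative, rank 2): at a Type-I
singularity where the blob hypothesis fails, some KNSS blow-up limit has ISOBARIC VORTEX LINES and
is not constant. K1 (BlobRiccatiClosure, rank 3): the blob hypothesis on the vorticity peaks is a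
continuation criterion (stretching Riccati law + BKM). K2 (IsobaricLinesLiouville, rank 4): bounded
ancient mild solutions with ω·∇q ≡ 0 are constant — a symmetry-free enlargement of both known KNSS
Liouville classes. N (NoTypeII, rank 5, shared stmt-0056). X ⇒ NoBlowup by pure logic (Sketch.lean
`noBlowup_of_cruxes`), and NoBlowup ⇒ Clay (A) by the shared assembly stmt-0055.
Lean: `∀ (ν T : ℝ), 0 < ν → 0 < T → ∀ (u : ℝ → EuclideanSpace ℝ (Fin 3) → EuclideanSpace ℝ (Fin 3))
(p : ℝ → EuclideanSpace ℝ (Fin 3) → ℝ), Literature.Analysis.FluidPDE.IsClassicalNSSolutionOn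
(Set.Ico 0 T) ν 0 u p → Literature.Analysis.FluidPDE.IsLerayHopfOn T ν 0 (u 0) u →
Literature.Analysis.FluidPDE.HasRapidSpatialDecay (u 0) →
Literature.Analysis.FluidPDE.HasSmoothExtensionPast ν 0 u T`

## Assembly
Pure logic (sorry-free `closes` in the planner's Sketch.lean / glue.lean, axioms
propext·choice·Quot.sound): apply the shared assembly stmt-0055 (NoBlowup → Clay A); given a
Leray–Hopf classical solution from a rapidly decaying datum on [0,T) that does not extend, it is
maximal, NoTypeII gives the Type-I rate; `by_cases` on the blob hypothesis: if it holds,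
BlobRiccatiClosure extends the solution (contradiction); if it fails, TubeAlternative produces a
non-constant KNSS blow-up limit with isobaric vortex lines and IsobaricLinesLiouville makes it
slice-wise constant (contradiction). The target NoBlowup and the two provable-now supports are
deliberately not hypotheses of `closes`.

Rationale: WHY THIS LINE. The card transplants Stern's level-set Gauss–Bonnet method (arXiv:1908.09754,
arXiv:1911.06754) and Reilly's integrated Bochner formula to the pressure Poisson equation Δp = 2Q =
½|ω|² − |S|²: two exact isobar identities (R), (GB) cap the non-local (Calderón–Zygmund) deviatoric
Hessian H inside mean-convex isobars (‖H‖ ≤ √(8/3)‖Q‖), floor it in χ = 0 tubes (‖H‖ ≥ √(2/3)‖Q‖,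
audit-sharpened) and charge χ = 2 blobs 8π of Gauss–Kronecker mass per unit depth — a
structure-by-structure answer to "the far field is adversarial" (doi:10.1017/jfm.2023.786,
doi:10.1063/1.3005832 for the phenomenology it explains). The route turns the card's blob/tube
dichotomy into statements Lean can hold by the Poincaré–Hopf dictionary: a regular isobar inside the
vortical set to which ω is tangent has χ = 0 (tube), a spherical isobar must be crossed by a vortex
line with an interior pressure minimum (blob, ∂²_ξp > 0 at the core bottom); so the tube branch
becomes a Liouville problem for bounded ancient mild solutions with isobaric vortex lines (ω·∇q ≡ 0)
— a class containing exactly the planar and axisymmetric-no-swirl cases where KNSS Liouville is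
known (arXiv:0709.3599 Thms 5.1–5.2) and the NS-pressure analogue of Arnold's Bernoulli tori for
steady Euler (doi:10.1007/b97593 Ch. II) — while the blob branch becomes a continuation criterion
closing the stretching Riccati law D_tα = |Sξ|² − 2α² − ∂²_ξp + ν(…) (Galanti–Gibbon–Heritage 1997,
book:lemarie-rieusset2016-navier-stokes-problem-21st-century p.374/p.787) through BKM (proved in
tree). Imported areas: level-set differential geometry / Morse–Poincaré–Hopf topology (dictionary
above), parabolic blow-up + Liouville rigidity (KNSS zoom, proved in tree as
`KNSS2009_blowup_generates_ancient_holds`), turbulence phenomenology only as calibration. What it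
does that TypeILiouville does not: it replaces the structureless conjecture (L) by the strictly
smaller isobaric-lines class plus a sign criterion, i.e. it spends the isobar topology to split (L);
what it does that HiddenConvexityPressureFloor does not: two-sided, per-structure, deviatoric
control instead of a global one-sided semiconcavity modulus. Negatives index empty.

RANKED CRUXES. #0 NoBlowup (target) — X ⇒ NoBlowup (shared stmt-NavierStokesRegularity-0054): for
every ν > 0, every finite-energy (Leray–Hopf) classical solution of unforced NS on ℝ³×[0,T) from a
rapidly decaying datum extends classically past T; obtained from TubeAlternative,
BlobRiccatiClosure, IsobaricLinesLiouville and NoTypeII by pure logic (term `noBlowup_of_cruxes` in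
the planner's Sketch.lean: not extendable ⇒ maximal ⇒ Type I ⇒ blob branch extends (contradiction)
or tube branch yields a non-constant isobaric-lines KNSS limit which the Liouville theorem makes
constant (contradiction)). (why it might fail: ¬NoBlowup is a finite-time singularity of a Clay
solution (= ¬Clay A); Hou's axisymmetric data (arXiv:2107.06509) and Tao's averaged blow-up
(arXiv:1402.0290) mark the territory the dichotomy must survive.) [arXiv:1402.0290,
arXiv:2107.06509, arXiv:0709.3599]
#2 TubeAlternative (crux) — TOMOGRAPHIC SELECTION AT A TYPE-I SINGULARITY (the card's thesis X, tube
half; card K2 front end). Let (u,p) be a maximal classical solution with finite lifespan T,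
Leray–Hopf from a rapidly decaying datum, blowing up at Type-I rate, and suppose the BLOB HYPOTHESIS
fails: there are no κ > 0, threshold function Ω(t) and t₀ < T such that for every t ∈ [t₀,T) the
superlevel set {|ω(·,t)| > Ω(t)} is non-empty and every point of it satisfies the axial pressure
convexity ∇²p(ω,ω) ≥ κ|ω|²Δp (i.e. ∂²_ξp ≥ 2κQ along the vorticity direction ξ, Q = Δp/2 = ¼|ω|² −
½|S|²; round blob κ = 1/3, straight column or ring core line 0, Burgers core −γ²). Then some KNSS
blow-up limit v of u (bounded ancient mild solution with ν = 1, smooth, |v| ≤ 1 = sup|v|: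
`IsKNSSBlowupLimit`, whose existence is the PROVED `KNSS2009_blowup_generates_ancient_holds`)
carries a classical pressure q on (−∞,0) with ISOBARIC VORTEX LINES, ω_v·∇q ≡ 0 on (−∞,0)×ℝ³, and is
not slice-wise constant. Dictionary to the card: by Poincaré–Hopf a regular isobar inside {ω_v ≠ 0}
to which ω_v is tangent is a torus — the TUBE branch χ = 0, where (GB) gives the zero Euler budget
and the floor ‖H‖ ≥ √(2/3)‖Q‖ in L²(dx/|∇q|); by the hairy-ball theorem a spherical isobar (χ = 2)
inside the vortical set is crossed by a vortex line on which q has an interior minimum, ∂_ξq = 0 ≤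
∂²_ξq — the blob hypothesis is the quantitative form of that at the parabolic scale, so its failure
is the persistence of χ = 0 structure down to the singular scale. Non-constancy folds in the Type-I
bookkeeping: scale-invariant bounds pass to the limit (AlbrittonBarker2019 arXiv:1811.00502 Thm 1.1,
Lemma 2.4), so a non-zero constant limit is excluded. Foreseen split (layer 2): ZoomWithPressure
(bookkeeping) → TomographicSelection (the bet). [deps: NoTypeII] [difficulty: XL] (why it might
fail: Poincaré–Hopf has no converse: χ=0 isobars do not force ω tangent to them; strained cores
(Burgers: ∂²_zp = −γ², ω·∇p ∝ −γ²z ≠ 0) are non-blob yet not isobaric-line, and nothing known kills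
the axial strain in a Type-I zoom limit.) [arXiv:0709.3599, arXiv:1811.00502, arXiv:1908.09754,
doi:10.1017/jfm.2023.786, doi:10.1016/j.cagd.2005.06.005, doi:10.1007/b97593]
#3 BlobRiccatiClosure (crux) — BLOB SELF-ATTENUATION AS A CONTINUATION CRITERION (card K1). A
finite-energy (Leray–Hopf) classical solution on [0,T) from a rapidly decaying datum which satisfies
the blob hypothesis — some κ > 0, threshold function Ω(t) and t₀ < T such that for t ∈ [t₀,T) the
peak set {|ω(·,t)| > Ω(t)} is non-empty and on it ∇²p(ω,ω) ≥ κ|ω|²Δp — extends classically past T.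
Mechanism: with α = ξ·Sξ the stretching Riccati law D_tα = |Sξ|² − 2α² − ∇²p(ξ,ξ) + ν(…)
(Galanti–Gibbon–Heritage, Nonlinearity 10 (1997) 1675, = ref [193] p.787 and p.374 of the held
Lemarié-Rieusset book; Majda–Bertozzi §1.4) has the axial pressure curvature as its one undecided
term; under the hypothesis ∇²p(ξ,ξ) ≥ 2κQ with Q ≫ |S|² in a self-attenuating core
(doi:10.1038/s41467-020-19530-1; H prevails over the nonlinearity in the most intense regions,
doi:10.1017/jfm.2023.786) one gets D_tα ≤ −α² + (1+κ)|S|² − κ|ω|²/2 on the peaks, sup-α over the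
peak set becomes time-integrable, d⁺/dt ‖ω‖∞ ≤ α(x*,t)‖ω‖∞ and BKM
(`Literature.Analysis.FluidPDE.beale_kato_majda_holds`, proved) continue the solution. The locality
cap (L) bounds what the far field can add in the core: ‖H‖_{L²(p<s)} ≤ √(8/3)‖Q‖_{L²(p<s)} inside a
mean-convex isobar. Vacuous-threshold abuse is blocked by the non-emptiness clause (the argmax of
|ω| always lies in the peak set). [difficulty: L] (why it might fail: the hypothesis bounds neither
|ξ×Sξ|² nor the viscous terms in D_tα, and α at the moving vorticity maximum is not transported; at
core edges |S| ~ |ω|, so κ|ω|²Δp need not dominate — the Lagrangian closure may not exist (Burgers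
cores are excluded by hypothesis, not handled).)
[book:lemarie-rieusset2016-navier-stokes-problem-21st-century, BealeKatoMajda1984,
doi:10.1038/s41467-020-19530-1, doi:10.1017/jfm.2023.786, doi:10.1063/1.3005832,
ConstantinFefferman1993]
#4 IsobaricLinesLiouville (crux) — LIOUVILLE FOR ISOBARIC VORTEX LINES (card K2, the 'tube
Liouville'). Every bounded ancient mild solution v of NS (ν = 1) on ℝ³×(−∞,0) admitting a classical
pressure q with ω_v·∇q ≡ 0 — vortex lines lie on isobars, so inside {ω_v ≠ 0} every compact regular
isobar is a torus (χ = 0) by Poincaré–Hopf — is constant on every time slice. The class contains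
both known cases of the KNSS Liouville conjecture, planar flows (KNSS arXiv:0709.3599 Thm 5.1: ω ∥
e₃, q independent of x₃) and axisymmetric flows without swirl (Thm 5.2 =
`Literature.Analysis.FluidPDE.knss_axisymmetric_no_swirl_holds`, proved in tree: ω = ω_θe_θ, q
independent of θ), plus parallel shear flows (heat-equation Liouville) and 2.5-D flows (reduced to
these by Thm 5.1); it is the symmetry-free enlargement the tube branch needs and is strictly smaller
than conjecture (L) (item TypeIliouvilleL of route TypeILiouville, which it replaces on this line;
(L) ⇒ this item). Structural ancestor: Arnold's theorem that Bernoulli surfaces of steady Euler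
flows carrying u and ω are tori or annuli (Arnold–Khesin, doi:10.1007/b97593 Ch. II §1).
[difficulty: open-problem] (why it might fail: no symmetry ⇒ no scalar equation with a maximum
principle (the engine of KNSS Thms 5.1–5.2); ω ⊥ ∇q is a pointwise constraint the flow does not
propagate; (L) is open even for steady bounded flows — one non-constant steady/travelling bounded
solution with isobaric vortex lines refutes it.) [arXiv:0709.3599, arXiv:0804.1803, arXiv:1011.5066,
Literature.Analysis.FluidPDE.knss_axisymmetric_no_swirl_holds, doi:10.1007/b97593]
#5 NoTypeII (crux) — NO TYPE II (shared with route TypeILiouville, stmt-NavierStokesRegularity-0056;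
re-asked verbatim): a maximal finite-energy classical solution from a rapidly decaying datum with
finite lifespan T blows up at Type-I rate ‖u(t)‖∞ ≤ C(T−t)^{-1/2} eventually. Needed here because
the tube branch runs through the KNSS zoom limit, whose non-constancy uses the scale-invariant
bounds only a Type-I rate provides; the blob branch does not use it. Ranked last on this route
because it is staffed through TypeILiouville (rank 2 there). [difficulty: open-problem] (why it
might fail: no theorem bounds a blow-up rate from above; Tao's averaged blow-up is Type II and every
axisymmetric singularity is Type II (KNSS2009 p.4), so Hou's axisymmetric scenario
(arXiv:2107.06509), if real, refutes it (= ¬Clay A).) [arXiv:0709.3599, arXiv:1402.0290,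
arXiv:2107.06509, Literature.Barriers.NavierStokesRegularity.AxisymmetricTypeIExclusion]
#9 FlatBochnerDivergence (support) — THE ENGINE OF (R) AND OF THE LOCALITY CAP (L) (card P1,
pointwise part, provable now): for p ∈ C³(ℝ³) and every x, div(Δp ∇p − ∇²p ∇p)(x) = (Δp(x))² −
|∇²p(x)|²_F (flat Bochner / Reilly identity; |·|_F the Frobenius norm, ∇²p∇p = D(∇p)[∇p]).
Integrated over a sub-level set {p < s} with regular value s and compact closure it gives (R):
∫_{p<s}[(Δp)² − |∇²p|²] = ∫_{p=s} H_Σ |∇p|² dσ (p constant on the boundary kills the tangential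
terms of Reilly's formula), equivalently ∫_{p<s}[(8/3)Q² − |H|²] = ∫ H_Σ|∇p|² with ∇²p = H +
(2Q/3)I, whence (L): ‖H‖_{L²(p<s)} ≤ √(8/3)‖Q‖_{L²(p<s)} = 0.816‖Δp‖ for a mean-convex isobar. The
divergence theorem on smooth sub-level sets and Reilly's formula (Indiana Univ. Math. J. 26 (1977)
459) are not in Mathlib (cite/definition requests filed); this item records the pointwise identity a
prover can close today. [difficulty: provable-now] [arXiv:1908.09754, arXiv:1911.06754]
#9 GaussKroneckerSplit (support) — THE POLYNOMIAL IDENTITY BEHIND (GB) (card P1/D1, provable now):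
for a symmetric 3×3 real matrix M and a unit vector n, 2·nᵀadj(M)n = (tr M − nᵀMn)² − |M|²_F +
2|Mn|² − (nᵀMn)². With M = ∇²p and n = ∇p/|∇p| the left side is 2K_Σ|∇p|² (Goldman,
doi:10.1016/j.cagd.2005.06.005: level-set Gauss curvature K_Σ = ∇pᵀadj(∇²p)∇p/|∇p|⁴), and the
substitution M = H + (2Q/3)I turns the right side into the (GB) integrand 2|Hn|² − |H|² −
(4/3)Q·H(n,n) + (8/9)Q²; coarea + Gauss–Bonnet then give the isobar Euler budget ∫_{a<p<b}(…)dx/|∇p|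
= 4π∫_a^b χ(Σ_s) ds, the tube floor ‖H‖ ≥ √(2/3)‖Q‖ (χ = 0, equality for the parabolic column) and
the blob charge 8π per unit depth (χ = 2). Checked numerically by the planner (random symmetric M,
unit n: residual < 1e-12); symmetry of M is necessary. [difficulty: provable-now]
[doi:10.1016/j.cagd.2005.06.005, arXiv:1908.09754]

TWO-LAYER PLAN. Foreseen glued splits (k ≤ 3, depth 1; nothing filed now). TubeAlternative ⇐
ZoomWithPressure (Type-I maximal Clay solution ⇒ a non-constant KNSS limit with a classical pressure
and an Albritton–Barker scale-invariant bound: bookkeeping over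
`KNSS2009_blowup_generates_ancient_holds`, KNSS §4 regularity, arXiv:1811.00502) →
TomographicSelection (failure of the blob hypothesis ⇒ the limit can be chosen with ω·∇q ≡ 0: the
(GB)/(T) tube-floor argument plus persistence of χ = 0 isobars under the zoom) → TubeAlternative.
BlobRiccatiClosure ⇐ PeakRiccati (under the blob hypothesis, D_tα ≤ C − α² on the peak set, a
Lagrangian inequality using (L)) → PeakToBKM (sup-α over the peaks integrable ⇒ ∫‖ω‖∞ < ∞ ⇒
`beale_kato_majda_holds`; needs the BKM class from Leray–Hopf + decay) → BlobRiccatiClosure.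
IsobaricLinesLiouville ⇐ steady case → Type-I-bounded (Albritton–Barker class) case → general
bounded ancient case.

KILL CRITERIA. A non-constant bounded ancient mild solution with a classical pressure and ω·∇q ≡ 0
refutes IsobaricLinesLiouville (and conjecture (L) with it): close `refuted:IsobaricLinesLiouville`
unless the witness violates a Type-I scale-invariant bound, in which case ONE repair restates K2
inside the Albritton–Barker Type-I class. BlobRiccatiClosure refuted by a Leray–Hopf / suitable weak
solution (outside the Clay class suffices to kill the mechanism) that satisfies the blob hypothesis
and is singular at T ⇒ close `refuted:BlobRiccatiClosure` and re-card the line as the card's counter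
alternative K3 (a priori bound on the isobar Euler budget). TubeAlternative can only be refuted
together with an actual Type-I singularity whose zoom limits all have ω·∇q ≢ 0 — that is ¬Clay A and
closes everything; a refuter's heuristic kill (a self-consistent strained-tube Type-I model with γ ↛
0 under zoom) forces a pivot of D to the Hessian-columnar variant restricted to vorticity peaks.
NoTypeII refuted = Type-II blow-up = ¬Clay A. Mooted: NoBlowup proved on any route; (L) proved on
TypeILiouville supersedes K2 and D at once (close `superseded --by
route-NavierStokesRegularity-TypeILiouville`).

NOT DECOMPOSED YET. The integral identities (R), (GB) themselves and the cap/floor/charge (L), (T),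
(B): they need the divergence theorem on smooth sub-level sets, coarea and Gauss–Bonnet for closed
surfaces in ℝ³, none of which Mathlib has — definition/cite requests filed, and only the pointwise
engines (FlatBochnerDivergence, GaussKroneckerSplit) are items. The isobar Euler budget B and the
card's critical-counter line K3 (a priori bound on B₊ + criticality bookkeeping (C) ⇒ no
signed-depth Type I): an ALTERNATIVE assembly of the same mechanism, to be opened as a sibling route
only if TubeAlternative dies. Constants (κ, the peak threshold), the Type-I transfer lemma and the
construction of the pressure of a KNSS limit (KNSS §4) are layer-2 children. docs/m5/inspiration not
read (plancard mode); no prior-programme decl reused.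

CHEAPEST FALSIFIER. For K2: hunt a non-constant bounded ancient (steady, travelling or
time-periodic) NS solution with ω·∇q ≡ 0 among the explicit families — planar, axisymmetric
no-swirl, parallel shear u = (f(y,z,t),0,0) (heat equation), 2.5-D (v₁,v₂,w)(x,y,t), Beltrami/ABC,
Burgers/Sullivan: the planner checked by hand that the first four are constant (KNSS Thms 5.1–5.2,
heat-equation Liouville; in 2.5-D the planar part is constant so q is, then w is a bounded ancient
caloric function) and that Beltrami/Burgers members are not bounded ancient NS solutions — survived,
30 minutes. For D: the Burgers calibration already shows the leak the refuter should press (non-blob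
AND non-isobaric-line: ∂²_zp = −γ², ω·∇p ∝ z); the decisive cheap datum is the sign of ∂²_ξp/Δp at
the vorticity peak along Hou's axisymmetric run (arXiv:2107.06509) or Kerr's antiparallel
reconnection data — if it stays ≤ 0 while |ω| grows and the structure is not ring/column-like, D is
implausible. GaussKroneckerSplit: `ring`-level (numerically 0 to 1e-12, done).

NUMBERS. Axial pressure curvature ∇²p(ξ,ξ)/Δp: round blob 1/3 (isotropic value; the blob hypothesis
asks any fixed κ > 0), straight column and ring core line 0, Burgers core −γ²/Δp < 0. Locality cap
‖H‖ ≤ √(8/3)‖Q‖ = 1.633‖Q‖ = 0.816‖Δp‖ (mean-convex isobar); tube floor ‖H‖ ≥ √(2/3)‖Q‖ = 0.408‖Δp‖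
in L²(dx/|∇p|) (χ = 0; audit AUDIT-17-g3 sharpened the card's (√3−1)/3 = 0.244; card's MC torus
0.415); blob charge 8π per unit pressure depth (χ = 2); card MC checks I/8π(b−a) = 1.0004, 1.0001,
0.9994 (spheres), −0.002 ± 0.007 (tori). DNS calibration: ω aligns with the smallest-eigenvalue
eigenvector of ∇²p in intense tubes, H^D enables and H^I depletes stretching, R_λ ≤ 1300
(doi:10.1017/jfm.2023.786). Type-I rate constant: Leray lower bound c√ν(T−t)^{-1/2}. Items at open:
8 (4 cruxes, 1 target, 2 supports, 1 assembly); 3 shared with TypeILiouville (0054, 0055, 0056).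

DEFINITION REQUESTS. After open: `isobarEulerBudget` (coarea form B(q;a,b) := 2∫_{a<q<b}
∇qᵀadj(∇²q)∇q/|∇q|³ dx = 4π∫_a^b χ(Σ_s) ds for regular values; topic Literature/Analysis/FluidPDE)
and `deviatoricHessian` (H := ∇²q − (Δq/3)I) — for TubeAlternative's layer-2 children and the K3
sibling. Cite facts wanted (kind cite, family ns): Reilly's integrated Bochner formula for a
function constant on the boundary (Reilly 1977, Indiana Univ. Math. J. 26, 459–472); level-set
Gauss–Bonnet + coarea (Stern arXiv:1908.09754 §2; Bray–Kazaras–Khuri–Stern arXiv:1911.06754 §§2–3);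
Poincaré–Hopf / hairy ball for closed surfaces in ℝ³ (Milnor). None is load-bearing for `closes`;
they are the layer-2 toolkit.

Novelty: Searches (2026-08-15, this planner): `lit search` ×3 ("regularity criterion Navier-Stokes pressure
Hessian vorticity direction", "Liouville theorem bounded ancient solutions Navier-Stokes vortex
lines pressure", typed + CLI) → searchd unavailable (rc 75) all session, recorded; `lit galaxy
search --star all`: "pressure Hessian along the vorticity" (0), "second derivative of the pressure
along the vortex" (0), "regularity criterion in terms of the pressure Hessian" (0), "vortex lines
lie on isobaric surfaces" (0), "Liouville theorem for ancient solutions" (1: geometric-analysis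
survey volume), "vortex lines lie on" (6 classical texts — Lamb/Bernoulli surfaces of STEADY flows),
"Lamb surfaces" (9; incl. arXiv:2404.18987 stagnation-pressure tubes, a diagnostic), "Vorticity
alignment results for the three-dimensional Euler" (3: GGH 1997 located, + doi:10.1063/1.3005832),
"nonlocal pressure Hessian" (3 closure/statistics papers); held
book:lemarie-rieusset2016-navier-stokes-problem-21st-century read pp.368, 374, 600–612, 787
(enstrophy production, GGH ref [193], §16.3 Liouville for steady solutions); the 57 route files of
this summit grepped for isobar / Gauss–Bonnet / level-set / pressure-Hessian (none with this
mechanism; HiddenConvexityPressureFloor nearest); plus the card's own searches and the refuter audit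
AUDIT-17-g3 (2026-08-15, grade new-combination, nearest prior Leung–Swaminathan–Davidson JFM 710
(2012) Minkowski-functional isosurface diagnostics).
Nearest prior art foun  [refs: 10.1063/1.3005832, 10.1007/b97593, 10.1017/jfm.2023.786, 10.1007/bf02096982, 2404.18987, 0709.3599, 1908.09754, doi:10.1063/1.3005832, book:lemarie-rieusset2016-navier-stokes-problem-21st-century, doi:10.1007/b97593, doi:10.1017/jfm.2023.786, doi:10.1007/bf02096982, KNSS2009]

Barriers (technique_class: level-set-gauss-bonnet pressure-topology liouville-rigidity): - technique_class: level-set-gauss-bonnet pressure-topology liouville-rigidity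
- Literature.Barriers.NavierStokesRegularity.TaoAveragedBlowup: evaded in class — the line uses the
LOCAL elliptic pressure (Δp = 2Q pointwise), the topology of real isobars and the tangency of real
vortex lines to them, structure an averaged bilinear operator does not possess; K2 and D run on
ESS/KNSS zoom + rigidity ('not manifestly subject' to the barrier, arXiv:1402.0290 p.8) and K1 on a
pointwise Riccati law, not on energy identity + function-space estimates.
- Literature.Barriers.NavierStokesRegularity.TruncatedDyadicBlowup: same evasion — no
dyadic/averaged model has isobars or vortex lines; nothing here is an abstract energy-plus-estimates
argument insensitive to the autonomy of the nonlinearity.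
- Literature.Barriers.NavierStokesRegularity.ComplexNavierStokesBlowup: evaded — level-surface
topology, Poincaré–Hopf and the sign structure Δp = ½|ω|² − |S|² are real-structure statements
meaningless for complex-valued (Li–Sinai) solutions.
- Literature.Barriers.NavierStokesRegularity.NavierStokesInequalitySingularSolution: NOT evaded by
(R)/(GB) alone (Scheffer's NSI solutions have a Poisson pressure too); every conclusion runs through
the momentum equation — mild/ancient structure and KNSS regularity in D and K2, the strain equation
behind the Riccati law in K1 — which NSI solutions violate. Stated so the critic need not.
- Literature.Barriers.NavierStokesRegularity.EnergySupercriticality: it d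

History (route lifecycle, newest last):
- 2026-09-04T10:53:05Z · DORMANT — reconciler: no traction for 5 d (last activity statement-claimed at 2026-08-30T10:20:50Z); parked, not closed — `ledger route dormant route-NavierStokesRegulari (operator:999:3950496)

sub-problem: NavierStokesRegularity · status: dormant · opened planner-plancard-NavierStokesRegularity-Navie-6917b856-0 2026-08-15T18:41:41Z · rev 1 · ledger route-NavierStokesRegularity-IsobarTomography
GENERATED by the gate from the ledger (D-0016/17). Provers cite these decls: `theorem foo : Summit.NavierStokesRegularity.NavierStokesRegularity.Theses.IsobarTomography.<Decl> := …` in Summits/NavierStokesRegularity/NavierStokesRegularity/Theorems/<Name>.lean.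
-/

namespace Summit.NavierStokesRegularity.NavierStokesRegularity.Theses.IsobarTomography

open scoped BigOperators Topology Manifold Classical MeasureTheory ProbabilityTheory Matrix InnerProductSpace ComplexConjugate ContinuousMap
open Filter Set Function TopologicalSpace MeasureTheory

attribute [summit_statement] _root_.NavierStokesRegularity

open Literature.NS

/-- item stmt-NavierStokesRegularity-0054 · target · rank 0 · open · by planner
why it might fail: ¬NoBlowup is a finite-time singularity of a Clay solution (= ¬Clay A); Hou's axisymmetric data (arXiv:2107.06509) and Tao's averaged blow-up (arXiv:1402.0290) mark the territory the dichotomy must survive.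
sources: arXiv:1402.0290, arXiv:2107.06509, arXiv:0709.3599
For every ν>0 and every classical solution (u,p) of unforced NS on ℝ³×[0,T) which is Leray–Hopf
(finite energy) from a rapidly decaying datum u(0), the solution extends as a classical solution
past T. Equivalent packaging of 'no finite-time singularity for the physical solution'. -/
@[route_item "route-NavierStokesRegularity-IsobarTomography"]
def NoBlowup : Prop :=
  ∀ (ν T : ℝ), 0 < ν → 0 < T → ∀ (u : ℝ → EuclideanSpace ℝ (Fin 3) → EuclideanSpace ℝ (Fin 3)) (p : ℝ → EuclideanSpace ℝ (Fin 3) → ℝ), Literature.Analysis.FluidPDE.IsClassicalNSSolutionOn (Set.Ico 0 T) ν 0 u p → Literature.Analysis.FluidPDE.IsLerayHopfOn T ν 0 (u 0) u → Literature.Analysis.FluidPDE.HasRapidSpatialDecay (u 0) → Literature.Analysis.FluidPDE.HasSmoothExtensionPast ν 0 u T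

/-- item stmt-NavierStokesRegularity-11739 · crux · rank 2 · open · by planner
why it might fail: Poincaré–Hopf has no converse: failed axial pressure convexity at the peaks forces no zoom limit with ω·∇q ≡ 0; strained cores (Burgers: ∂²_zp = −γ² < 0, ω·∇p = −γ²zω_z ≢ 0) are non-blob AND non-isobaric, and nothing known kills axial strain under Type-I rescaling.
sources: arXiv:0709.3599, arXiv:1811.00502, doi:10.1017/jfm.2023.786, doi:10.1063/1.3005832, doi:10.1007/b97593, arXiv:1908.09754
[crux] TOMOGRAPHIC SELECTION AT A TYPE-I SINGULARITY (the card's thesis X, tube half; card K2 front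
end). Let (u,p) be a maximal classical solution with finite lifespan T, Leray–Hopf from a rapidly
decaying datum, blowing up at Type-I rate, and suppose the BLOB HYPOTHESIS fails: there are no κ >
0, threshold function Ω(t) and t₀ < T such that for every t ∈ [t₀,T) the superlevel set {|ω(·,t)| >
Ω(t)} is non-empty and every point of it satisfies the axial pressure convexity ∇²p(ω,ω) ≥ κ|ω|²Δp
(i.e. ∂²_ξp ≥ 2κQ along the vorticity direction ξ, Q = Δp/2 = ¼|ω|² − ½|S|²; round blob κ = 1/3,
straight column or ring core line 0, Burgers core −γ²). Then some KNSS blow-up limit v of u (bounded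
ancient mild solution with ν = 1, smooth, |v| ≤ 1 = sup|v|: `IsKNSSBlowupLimit`, whose existence is
the PROVED `KNSS2009_blowup_generates_ancient_holds`) carries a classical pressure q on (−∞,0) with
ISOBARIC VORTEX LINES, ω_v·∇q ≡ 0 on (−∞,0)×ℝ³, and is not slice-wise constant. Dictionary to the
card: by Poincaré–Hopf a regular isobar inside {ω_v ≠ 0} to which ω_v is tangent is a torus — the
TUBE branch χ = 0, where (GB) gives the zero Euler budget and the floor ‖H‖ ≥ √(2/3)‖Q‖ in
L²(dx/|∇q|); by the -/
@[route_item "route-NavierStokesRegularity-IsobarTomography"]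
def TubeAlternative : Prop :=
  ∀ (ν T : ℝ), 0 < ν → 0 < T → ∀ (u : ℝ → EuclideanSpace ℝ (Fin 3) → EuclideanSpace ℝ (Fin 3)) (p : ℝ → EuclideanSpace ℝ (Fin 3) → ℝ), Literature.Analysis.FluidPDE.IsMaximalSmoothSolution ν 0 u p T → Literature.Analysis.FluidPDE.IsLerayHopfOn T ν 0 (u 0) u → Literature.Analysis.FluidPDE.HasRapidSpatialDecay (u 0) → Literature.Analysis.FluidPDE.IsTypeIBlowup u T → (¬ ∃ κ : ℝ, 0 < κ ∧ ∃ Ω : ℝ → ℝ, ∃ t₀ ∈ Set.Ico 0 T, ∀ t ∈ Set.Ico t₀ T, (∃ x : EuclideanSpace ℝ (Fin 3), Ω t < ‖Literature.Analysis.FluidPDE.curl (u t) x‖) ∧ ∀ x : EuclideanSpace ℝ (Fin 3), Ω t < ‖Literature.Analysis.FluidPDE.curl (u t) x‖ → κ * ‖Literature.Analysis.FluidPDE.curl (u t) x‖ ^ 2 * Laplacian.laplacian (p t) x ≤ iteratedFDeriv ℝ 2 (p t) x ![Literature.Analysis.FluidPDE.curl (u t) x, Literature.Analysis.FluidPDE.curl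 (u t) x]) → ∃ (v : ℝ → EuclideanSpace ℝ (Fin 3) → EuclideanSpace ℝ (Fin 3)) (q : ℝ → EuclideanSpace ℝ (Fin 3) → ℝ), Literature.Analysis.FluidPDE.IsKNSSBlowupLimit v ∧ Literature.Analysis.FluidPDE.IsClassicalNSSolutionOn (Set.Iio 0) 1 0 v q ∧ (∀ t < 0, ∀ x : EuclideanSpace ℝ (Fin 3), inner ℝ (Literature.Analysis.FluidPDE.curl (v t) x) (gradient (q t) x) = 0) ∧ ¬ (∀ t < 0, ∃ b : EuclideanSpace ℝ (Fin 3), v t = fun _ => b)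

/-- item stmt-NavierStokesRegularity-11740 · crux · rank 3 · open · by planner
why it might fail: The hypothesis signs only ρ = ∇²p(ξ,ξ) against Δp at the peaks; D_tα = |Sξ|² − 2α² − ρ + ν(…) closes only if [|Sξ|² − 2α² − ρ]_+ is controlled (Chae–Constantin: sup over all x, Euler); |Sξ|², viscous terms and the moving argmax are free, so sup-α need not be integrable.
sources: doi:10.1007/s00332-021-09734-0, doi:10.1093/imrn/rnab014, BealeKatoMajda1984, book:lemarie-rieusset2016-navier-stokes-problem-21st-century, doi:10.1038/s41467-020-19530-1, doi:10.1017/jfm.2023.786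
[crux] BLOB SELF-ATTENUATION AS A CONTINUATION CRITERION (card K1). A finite-energy (Leray–Hopf)
classical solution on [0,T) from a rapidly decaying datum which satisfies the blob hypothesis — some
κ > 0, threshold function Ω(t) and t₀ < T such that for t ∈ [t₀,T) the peak set {|ω(·,t)| > Ω(t)} is
non-empty and on it ∇²p(ω,ω) ≥ κ|ω|²Δp — extends classically past T. Mechanism: with α = ξ·Sξ the
stretching Riccati law D_tα = |Sξ|² − 2α² − ∇²p(ξ,ξ) + ν(…) (Galanti–Gibbon–Heritage, Nonlinearity
10 (1997) 1675, = ref [193] p.787 and p.374 of the held Lemarié-Rieusset book; Majda–Bertozzi §1.4)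
has the axial pressure curvature as its one undecided term; under the hypothesis ∇²p(ξ,ξ) ≥ 2κQ with
Q ≫ |S|² in a self-attenuating core (doi:10.1038/s41467-020-19530-1; H prevails over the
nonlinearity in the most intense regions, doi:10.1017/jfm.2023.786) one gets D_tα ≤ −α² + (1+κ)|S|²
− κ|ω|²/2 on the peaks, sup-α over the peak set becomes time-integrable, d⁺/dt ‖ω‖∞ ≤ α(x*,t)‖ω‖∞
and BKM (`Literature.Analysis.FluidPDE.beale_kato_majda_holds`, proved) continue the solution. The
locality cap (L) bounds what the far field can add in the core: ‖H‖_{L²(p<s)} ≤ √(8/3)‖Q‖_{L²(p<s)}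
inside a mean-con -/
@[route_item "route-NavierStokesRegularity-IsobarTomography"]
def BlobRiccatiClosure : Prop :=
  ∀ (ν T : ℝ), 0 < ν → 0 < T → ∀ (u : ℝ → EuclideanSpace ℝ (Fin 3) → EuclideanSpace ℝ (Fin 3)) (p : ℝ → EuclideanSpace ℝ (Fin 3) → ℝ), Literature.Analysis.FluidPDE.IsClassicalNSSolutionOn (Set.Ico 0 T) ν 0 u p → Literature.Analysis.FluidPDE.IsLerayHopfOn T ν 0 (u 0) u → Literature.Analysis.FluidPDE.HasRapidSpatialDecay (u 0) → (∃ κ : ℝ, 0 < κ ∧ ∃ Ω : ℝ → ℝ, ∃ t₀ ∈ Set.Ico 0 T, ∀ t ∈ Set.Ico t₀ T, (∃ x : EuclideanSpace ℝ (Fin 3), Ω t < ‖Literature.Analysis.FluidPDE.curl (u t) x‖) ∧ ∀ x : EuclideanSpace ℝ (Fin 3), Ω t < ‖Literature.Analysis.FluidPDE.curl (u t) x‖ → κ * ‖Literature.Analysis.FluidPDE.curl (u t) x‖ ^ 2 * Laplacian.laplacian (p t) x ≤ iteratedFDeriv ℝ 2 (p t) x ![Literature.Analysis.FluidPDE.curl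 (u t) x, Literature.Analysis.FluidPDE.curl (u t) x]) → Literature.Analysis.FluidPDE.HasSmoothExtensionPast ν 0 u T

/-- item stmt-NavierStokesRegularity-11741 · crux · rank 4 · open · by planner
why it might fail: Liouville for bounded ancient NS is open in 3D even for steady flows (KNSS §1, §5; Seregin 2016); ω·∇q ≡ 0 gives no scalar maximum-principle quantity (the engine of KNSS Thms 5.1–5.2) and is not propagated; one non-constant bounded steady/ancient solution with isobaric vortex lines refutes it.
sources: arXiv:0709.3599, arXiv:1811.00502, arXiv:1011.5066, arXiv:0804.1803, doi:10.1088/0951-7715/29/8/2191, Literature.Analysis.FluidPDE.knss_axisymmetric_no_swirl_holds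
[crux] LIOUVILLE FOR ISOBARIC VORTEX LINES (card K2, the 'tube Liouville'). Every bounded ancient
mild solution v of NS (ν = 1) on ℝ³×(−∞,0) admitting a classical pressure q with ω_v·∇q ≡ 0 — vortex
lines lie on isobars, so inside {ω_v ≠ 0} every compact regular isobar is a torus (χ = 0) by
Poincaré–Hopf — is constant on every time slice. The class contains both known cases of the KNSS
Liouville conjecture, planar flows (KNSS arXiv:0709.3599 Thm 5.1: ω ∥ e₃, q independent of x₃) and
axisymmetric flows without swirl (Thm 5.2 =
`Literature.Analysis.FluidPDE.knss_axisymmetric_no_swirl_holds`, proved in tree: ω = ω_θe_θ, q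
independent of θ), plus parallel shear flows (heat-equation Liouville) and 2.5-D flows (reduced to
these by Thm 5.1); it is the symmetry-free enlargement the tube branch needs and is strictly smaller
than conjecture (L) (item TypeIliouvilleL of route TypeILiouville, which it replaces on this line;
(L) ⇒ this item). Structural ancestor: Arnold's theorem that Bernoulli surfaces of steady Euler
flows carrying u and ω are tori or annuli (Arnold–Khesin, doi:10.1007/b97593 Ch. II §1).
[difficulty: open-problem] -/
@[route_item "route-NavierStokesRegularity-IsobarTomography"]
def IsobaricLinesLiouville : Prop :=
  ∀ (v : ℝ → EuclideanSpace ℝ (Fin 3) → EuclideanSpace ℝ (Fin 3)) (q : ℝ → EuclideanSpace ℝ (Fin 3) → ℝ), Literature.Analysis.FluidPDE.IsBoundedAncientMildSolution 1 v → Literature.Analysis.FluidPDE.IsClassicalNSSolutionOn (Set.Iio 0) 1 0 v q → (∀ t < 0, ∀ x : EuclideanSpace ℝ (Fin 3), inner ℝ (Literature.Analysis.FluidPDE.curl (v t) x) (gradient (q t) x) = 0) → ∀ t < 0, ∃ b : EuclideanSpace ℝ (Fin 3), v t = fun _ => b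

/-- item stmt-NavierStokesRegularity-0056 · crux · rank 5 · open · by planner
why it might fail: no theorem bounds a blow-up rate from above; Tao's averaged blow-up is Type II and every axisymmetric singularity is Type II (KNSS2009 p.4), so Hou's axisymmetric scenario (arXiv:2107.06509), if real, refutes it (= ¬Clay A).
sources: arXiv:0709.3599, arXiv:1402.0290, arXiv:2107.06509, Literature.Barriers.NavierStokesRegularity.AxisymmetricTypeIExclusion
If a finite-energy classical solution from a rapidly decaying datum has maximal lifespan T<∞ (no
classical extension past T), then ‖u(t)‖_∞ ≤ C (T−t)^{-1/2} eventually as t↑T (Leray's rate is the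
matching lower bound, leray_blowup_rate_top). The hardest and most informative crux: a
counterexample is a Type II singularity, i.e. ¬(Clay A). Known: lower bound c√ν (T−t)^{-1/2} (Leray
1934 §20); L³ must blow up (ESS 2003, Seregin 2012); only triple-log quantitative gain (Tao 2021). -/
@[route_item "route-NavierStokesRegularity-IsobarTomography"]
def NoTypeII : Prop :=
  ∀ (ν T : ℝ), 0 < ν → 0 < T → ∀ (u : ℝ → EuclideanSpace ℝ (Fin 3) → EuclideanSpace ℝ (Fin 3)) (p : ℝ → EuclideanSpace ℝ (Fin 3) → ℝ), Literature.Analysis.FluidPDE.IsMaximalSmoothSolution ν 0 u p T → Literature.Analysis.FluidPDE.IsLerayHopfOn T ν 0 (u 0) u → Literature.Analysis.FluidPDE.HasRapidSpatialDecay (u 0) → Literature.Analysis.FluidPDE.IsTypeIBlowup u T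

/-- item stmt-NavierStokesRegularity-11742 · support · rank 9 · closed · proved by Summit.NavierStokesRegularity.NavierStokesRegularity.Theorems.isobarTomography_flatBochnerDivergence_proof (prover) · by planner
sources: arXiv:1908.09754, arXiv:1911.06754
[support] THE ENGINE OF (R) AND OF THE LOCALITY CAP (L) (card P1, pointwise part, provable now): for
p ∈ C³(ℝ³) and every x, div(Δp ∇p − ∇²p ∇p)(x) = (Δp(x))² − |∇²p(x)|²_F (flat Bochner / Reilly
identity; |·|_F the Frobenius norm, ∇²p∇p = D(∇p)[∇p]). Integrated over a sub-level set {p < s} with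
regular value s and compact closure it gives (R): ∫_{p<s}[(Δp)² − |∇²p|²] = ∫_{p=s} H_Σ |∇p|² dσ (p
constant on the boundary kills the tangential terms of Reilly's formula), equivalently
∫_{p<s}[(8/3)Q² − |H|²] = ∫ H_Σ|∇p|² with ∇²p = H + (2Q/3)I, whence (L): ‖H‖_{L²(p<s)} ≤
√(8/3)‖Q‖_{L²(p<s)} = 0.816‖Δp‖ for a mean-convex isobar. The divergence theorem on smooth sub-level
sets and Reilly's formula (Indiana Univ. Math. J. 26 (1977) 459) are not in Mathlib (cite/definition
requests filed); this item records the pointwise identity a prover can close today. [difficulty: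
provable-now] -/
@[route_item "route-NavierStokesRegularity-IsobarTomography"]
def FlatBochnerDivergence : Prop :=
  ∀ (p : EuclideanSpace ℝ (Fin 3) → ℝ), ContDiff ℝ 3 p → ∀ x : EuclideanSpace ℝ (Fin 3), Literature.Analysis.FluidPDE.VectorCalculus.divergence (fun y => Laplacian.laplacian p y • gradient p y - (fderiv ℝ (gradient p) y) (gradient p y)) x = (Laplacian.laplacian p x) ^ 2 - Literature.Analysis.FluidPDE.frobeniusNormSq (fderiv ℝ (gradient p) x)

-- `FlatBochnerDivergence` holds: proved by `Summit.NavierStokesRegularity.NavierStokesRegularity.Theorems.isobarTomography_flatBochnerDivergence_proof` (its module imports this route file, so no `_holds` link can be stated here).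

/-- item stmt-NavierStokesRegularity-11743 · support · rank 9 · closed · proved by Summit.NavierStokesRegularity.NavierStokesRegularity.Theorems.gaussKroneckerSplit_proof @ 2b223ce042c7 (prover) · by planner
sources: doi:10.1016/j.cagd.2005.06.005, arXiv:1908.09754
[support] THE POLYNOMIAL IDENTITY BEHIND (GB) (card P1/D1, provable now): for a symmetric 3×3 real
matrix M and a unit vector n, 2·nᵀadj(M)n = (tr M − nᵀMn)² − |M|²_F + 2|Mn|² − (nᵀMn)². With M = ∇²p
and n = ∇p/|∇p| the left side is 2K_Σ|∇p|² (Goldman, doi:10.1016/j.cagd.2005.06.005: level-set Gauss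
curvature K_Σ = ∇pᵀadj(∇²p)∇p/|∇p|⁴), and the substitution M = H + (2Q/3)I turns the right side into
the (GB) integrand 2|Hn|² − |H|² − (4/3)Q·H(n,n) + (8/9)Q²; coarea + Gauss–Bonnet then give the
isobar Euler budget ∫_{a<p<b}(…)dx/|∇p| = 4π∫_a^b χ(Σ_s) ds, the tube floor ‖H‖ ≥ √(2/3)‖Q‖ (χ = 0,
equality for the parabolic column) and the blob charge 8π per unit depth (χ = 2). Checked
numerically by the planner (random symmetric M, unit n: residual < 1e-12); symmetry of M is
necessary. [difficulty: provable-now] -/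
@[route_item "route-NavierStokesRegularity-IsobarTomography"]
def GaussKroneckerSplit : Prop :=
  ∀ (M : Matrix (Fin 3) (Fin 3) ℝ), M.IsSymm → ∀ n : Fin 3 → ℝ, n ⬝ᵥ n = 1 → 2 * (n ⬝ᵥ (M.adjugate *ᵥ n)) = (M.trace - n ⬝ᵥ (M *ᵥ n)) ^ 2 - (∑ i, ∑ j, M i j ^ 2) + 2 * ((M *ᵥ n) ⬝ᵥ (M *ᵥ n)) - (n ⬝ᵥ (M *ᵥ n)) ^ 2

-- `GaussKroneckerSplit` holds: proved by `Summit.NavierStokesRegularity.NavierStokesRegularity.Theorems.gaussKroneckerSplit_proof` @ 2b223ce042c7 (its module imports this route file, so no `_holds` link can be stated here).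

/-- item stmt-NavierStokesRegularity-0055 · assembly · rank 1 · closed · proved by Summit.NavierStokesRegularity.NavierStokesRegularity.Theorems.typeICertificateLadder_noBlowupToClay_proof @ 8d57e70af7e2 (prover) · by planner
sources: Leray1934, Fefferman2000, arXiv:0709.3599
Given NoBlowup, build the Clay (A) solution: local finite-energy classical solution for smooth
divergence-free rapidly decaying data (Leray 1934 §III / Fujita–Kato 1964 + LPS smoothing), continue
past every T using NoBlowup, glue by weak–strong uniqueness (Prodi–Serrin), bounded energy from the
energy inequality, and convert with
Literature.Analysis.FluidPDE.isNavierStokesSolution_and_smooth_iff. Blow-up at spatial infinity is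
excluded by CKN ε-regularity applied far out. May take named Literature facts (leray_existence_R3,
ladyzhenskaya_prodi_serrin, weak_strong_uniqueness, fujita_kato_local) as hypotheses if the grounder
so rules. -/
@[route_item "route-NavierStokesRegularity-IsobarTomography"]
def Assembly : Prop :=
  (∀ (ν T : ℝ), 0 < ν → 0 < T → ∀ (u : ℝ → EuclideanSpace ℝ (Fin 3) → EuclideanSpace ℝ (Fin 3)) (p : ℝ → EuclideanSpace ℝ (Fin 3) → ℝ), Literature.Analysis.FluidPDE.IsClassicalNSSolutionOn (Set.Ico 0 T) ν 0 u p → Literature.Analysis.FluidPDE.IsLerayHopfOn T ν 0 (u 0) u → Literature.Analysis.FluidPDE.HasRapidSpatialDecay (u 0) → Literature.Analysis.FluidPDE.HasSmoothExtensionPast ν 0 u T) → NavierStokesRegularity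

/-- `Assembly` holds: proved by `Summit.NavierStokesRegularity.NavierStokesRegularity.Theorems.typeICertificateLadder_noBlowupToClay_proof` @ 8d57e70af7e2. -/
theorem Assembly_holds : Assembly := _root_.Summit.NavierStokesRegularity.NavierStokesRegularity.Theorems.typeICertificateLadder_noBlowupToClay_proof

/-! D-0027 §2.1 — DECIDING THEOREM (planner-authored via `route open/edit --closes-file`; by planner-plancard-NavierStokesRegularity-Navie-6917b856-0 2026-08-15T18:41:42Z):
its hypotheses are this route's items and its conclusion the sub-problem Statement (glue_lint), and it elaborates with this file. -/

/-- D-0027 §2.1 deciding theorem for route IsobarTomography: the cruxes decide Clay (A).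
Given a finite-energy (Leray–Hopf) classical solution `(u,p)` on `[0,T)` from a rapidly decaying
datum, suppose it does not extend past `T`; then it is maximal, `NoTypeII` gives the Type-I rate;
if the blob hypothesis holds, `BlobRiccatiClosure` extends the solution (contradiction); if it
fails, `TubeAlternative` yields a non-constant KNSS blow-up limit with isobaric vortex lines and
`IsobaricLinesLiouville` makes it slice-wise constant (contradiction). Hence NoBlowup, and the
shared assembly item `Assembly` (stmt-0055) returns `NavierStokesRegularity`. The target
`NoBlowup` and the supports `FlatBochnerDivergence`, `GaussKroneckerSplit` are deliberately not
hypotheses. -/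
@[closes "route-NavierStokesRegularity-IsobarTomography"] theorem closes (hII : NoTypeII) (hD : TubeAlternative) (hB : BlobRiccatiClosure)
    (hL : IsobaricLinesLiouville) (hA : Assembly) : _root_.NavierStokesRegularity := by
  apply hA
  intro ν T hν hT u p hcl hLH hdec
  by_contra hext
  have hmax : Literature.Analysis.FluidPDE.IsMaximalSmoothSolution ν 0 u p T := ⟨hcl, hext⟩
  have hI := hII ν T hν hT u p hmax hLH hdec
  by_cases hblob : ∃ κ : ℝ, 0 < κ ∧ ∃ Ω : ℝ → ℝ, ∃ t₀ ∈ Set.Ico 0 T, ∀ t ∈ Set.Ico t₀ T, (∃ x : EuclideanSpace ℝ (Fin 3), Ω t < ‖Literature.Analysis.FluidPDE.curl (u t) x‖) ∧ ∀ x : EuclideanSpace ℝ (Fin 3), Ω t < ‖Literature.Analysis.FluidPDE.curl (u t) x‖ → κ * ‖Literature.Analysis.FluidPDE.curl (u t) x‖ ^ 2 * Laplacian.laplacian (p t) x ≤ iteratedFDeriv ℝ 2 (p t) x ![Literature.Analysis.FluidPDE.curl (u t) x, Literature.Analysis.FluidPDE.curl (u t) x]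
  · exact hext (hB ν T hν hT u p hcl hLH hdec hblob)
  · obtain ⟨v, q, hv, hvq, hcol, hnc⟩ := hD ν T hν hT u p hmax hLH hdec hI hblob
    exact hnc (hL v q hv.isBoundedAncientMildSolution hvq hcol)

end Summit.NavierStokesRegularity.NavierStokesRegularity.Theses.IsobarTomography
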